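import Literature.AlgebraicGeometry.Deformation.SmoothLiftObstructionCechCochainQuot
import HarnessLib

/-!
# Transport of a lifted atlas along an isomorphism: the obstruction cochain read back through the closed-fibre identification
# ([Hartshorne2010] Thm. 10.2 (a) proof, Remark 10.2.2; [Oort1971] §2.2)

Layer `Literature/AlgebraicGeometry/Deformation`, namespace `Literature.AlgebraicGeometry.Deformation.AtlasTransportClassQuot`.
PROOF FILE, THEOREMS ONLY (no definition, no instance, no notation, no named fact, no `sorry`).  Cell `hodgecm-mathlib`, P6 sub-desk P6b,
deal (vii-d)-B «ČECH READBACK ALONG σ» (20:44:30Z); count-neutral ★ capital.  Sequel of ★ (vii-d) `SmoothLiftAtlasTransportQuot` (the face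
readings of the atlas transported along `σ : X₀ ⥲ X₀'` are the `s̄`-conjugates of the original ones, `reading_transport`) in the currency of ★
(vii) `SmoothLiftObstructionCechCochainQuot` (closed fibre `X : Over (Spec κ)`, `A' ↠ κ`, `[∀ W, Algebra A' Γ(X, W)]` + `halg`, principal small
extension `φ : ↥J ≃ₗ[A'] κ`, «`o` REPRESENTS `δ`» := `∀ c, δ c = o(dc) ⊗ t`, `t = φ⁻¹ 1`).

THE PRINT. [Hartshorne2010, Thm. 10.2 (a) (proof), p. 81 and Cor. 10.3 (a), p. 82]: there is just ONE obstruction ([Hartshorne2010, Remark 10.2.2,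
p. 82]: automorphisms over the identity are `H⁰(X₀, 𝒯⁰ ⊗ J)` — the currency of readings and their representing sections); [Oort1971, §2.2, pp. 277–279]: `D(X′; R → R′)` «does not
depend on the choices made» and behaves functorially.  HONEST CHOICE OF CURRENCY (desk (B1)): the tree has the pull-back of Čech cochains along a
morphism for the STRUCTURE sheaf only (★ `Morphisms/CechModuleUnitH2Pullback.cechComapC2`), not for the tangent sheaf `𝒯_{X/κ}`; rather than build
`σ_κ^*` on `Č²(𝒰; 𝒯)` through `𝒯_{X_κ} ≅ σ_κ^* 𝒯_{X'_κ}`, this file states the readback COMPONENTWISE through the closed-fibre ring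
identifications `s̄` (for the canonical closed fibres: `s̄ := σ_κ♯` on the trace opens) — the form in which the (U-ab) road pairs classes with
global `1`-forms and pulls back STRUCTURE-sheaf cochains (★ char-0 road `AbelianObstruction*`, ★ `cechComapC2`).

* §1 `coeff_transport` — ring level: if `δ (s̄ x) = (s̄ ⊗ 1)(δ' x)` and `δ' = D' ⊗ t`, `δ = D ⊗ t` coordinatewise, then `D (s̄ c) = s̄ (D' c)`
  (`c ⊗ t` has unique coordinates, ★ (vii) §1).
* §2 **`tangentSheaf_section_rep_transport`** — on affine opens `W' ⊆ X'_κ`, `W ⊆ X_κ` identified by `s̄ : Γ(W') ≃ₐ[A'] Γ(W)`: if `θ'` represents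
  `δ'` and `θ` represents the `s̄`-conjugate `δ`, then `θ(d(s̄ c)) = s̄ (θ'(dc))` — the representing section of the transported reading IS the original
  one read back through `s̄`; and the converse **`rep_of_readback`** (a section whose values are the `s̄`-readback of `θ'`'s represents `δ`).
* §3 **`cochain_rep_transport`** — on principal affine covers indexed alike (`U'` on `X'_κ`, `U` on `X_κ`, triple identifications `s̄_{abd}`):
  cochains `o'`, `o` representing the original and the transported face readings agree componentwise through `s̄`:
  `o_{abd}(d(s̄ c)) = s̄_{abd}(o'_{abd}(dc))`; `cochain_rep_of_readback` (converse); with ★ `cochain_rep_unique` the transported cochain is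
  therefore DETERMINED by `o'` and `s̄`.
NOT HERE (stated plainly): (B3) «`[o] = 0 ⇔ [o'] = 0`» is NOT a corollary in this component currency — it needs the `s̄`-transport of `1`-cochains
and `d¹` (the restriction-compatibility of `s̄`), i.e. the readings-exactness route of ★ (vii-b) A∕B, ≈ 150 l., a separate file if worded; the
LINEAR action `σ_κ^*` on `Ȟ²(𝒰; 𝒯)` needed by the `[-1]`-argument belongs with (U-ab) (c).

HC_CM is proved only modulo the printed citations until rung 0 closes; nothing here bears on a summit statement.
## References
* [Hartshorne2010] R. Hartshorne, *Deformation Theory*, GTM 257, Springer (2010): Thm. 10.2 (a) and its proof (p. 81), Remark 10.1.1 (p. 81),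
  Remark 10.2.2 (p. 82), Cor. 10.3 (a) (p. 82), Notation 6.1 (p. 46).
* [Oort1971] F. Oort, *Finite group schemes, local moduli for abelian varieties, and lifting problems*, Compositio Math. 23 (1971), §2.2
  (pp. 277–280).
-/

noncomputable section

-- `TopCat.Presheaf`/`TopCat.Sheaf` are not reducible (as in Mathlib's `AlgebraicGeometry/Modules`).
set_option backward.isDefEq.respectTransparency false

open CategoryTheory AlgebraicGeometry Opposite TopologicalSpace
open scoped TensorProduct

universe u

namespace Literature.AlgebraicGeometry.Deformation.AtlasTransportClassQuot

open Literature.AlgebraicGeometry.HodgeTheory Literature.AlgebraicGeometry.Modules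
  Literature.AlgebraicGeometry.Motives Literature.AlgebraicGeometry.Morphisms
  Literature.AlgebraicGeometry.Deformation.LiftObstructionCechClassQuot

/-! ## §1 Ring level: coordinates of `s̄`-conjugate readings -/

section Coeff

variable {A' : Type*} [CommRing A'] {κ : Type*} [Field κ] [Algebra A' κ] (hκ : Function.Surjective (algebraMap A' κ))
  (J : Ideal A') (φ : ↥J ≃ₗ[A'] κ)
  {B₀ : Type*} [CommRing B₀] [Algebra A' B₀] [Algebra κ B₀] [IsScalarTower A' κ B₀]
  {B₀' : Type*} [CommRing B₀'] [Algebra A' B₀']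

include hκ in
/-- **Coordinates transport through `s̄`:** if `δ (s̄ x) = (s̄ ⊗ 1)(δ' x)`, `δ' c = D' c ⊗ t` and `δ c = D c ⊗ t`, then `D (s̄ c) = s̄ (D' c)`
(unique coordinates in `B₀ ⊗ t`, ★ (vii) `tmul_symm_one_injective`). [cite: Hartshorne2010, Notation 6.1 (p. 46)] [cite: Hartshorne2010, Remark 10.2.2, p. 82] -/
theorem coeff_transport (sbar : B₀' ≃ₐ[A'] B₀) {δ' : B₀' → B₀' ⊗[A'] ↥J} {δ : B₀ → B₀ ⊗[A'] ↥J}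
    (hδ : ∀ x, δ (sbar x) = LinearMap.rTensor ↥J sbar.toLinearMap (δ' x)) {D' : B₀' → B₀'} {D : B₀ → B₀}
    (hD' : ∀ c, δ' c = D' c ⊗ₜ φ.symm 1) (hD : ∀ c, δ c = D c ⊗ₜ φ.symm 1) (c : B₀') : D (sbar c) = sbar (D' c) :=
  LiftObstructionCechClassQuot.tmul_symm_one_injective hκ J φ
    (by rw [← hD, hδ, hD', LinearMap.rTensor_tmul, AlgEquiv.toLinearMap_apply])

end Coeff

/-! ## §2 Sections of the tangent sheaves representing conjugate readings -/

variable {A' : Type u} [CommRing A'] {κ : Type u} [Field κ] [Algebra A' κ] (hκ : Function.Surjective (algebraMap A' κ))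
  {X : Over (Spec (CommRingCat.of κ))} [instΓ : ∀ W : X.left.Opens, Algebra A' Γ(X.left, W)]
  (halg : ∀ (W : X.left.Opens) (a : A'), algebraMap A' Γ(X.left, W) a = (constToPresheaf X).app (op W) (algebraMap A' κ a))
  {X' : Over (Spec (CommRingCat.of κ))} [instΓ' : ∀ W' : X'.left.Opens, Algebra A' Γ(X'.left, W')]
  (J : Ideal A') (φ : ↥J ≃ₗ[A'] κ)

section Section

include hκ halg in
/-- **The representing section of a transported reading is the original one read back through `s̄`.**  On opens `W' ⊆ X'_κ`, `W ⊆ X_κ` with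
sections identified by `s̄ : Γ(W') ≃ₐ[A'] Γ(W)` (e.g. `σ_κ♯` on a trace open and its preimage): if `θ'` represents the reading `δ'` and `θ` represents a
reading `δ` with `δ (s̄ x) = (s̄ ⊗ 1)(δ' x)` (★ (vii-d) `reading_transport`), then `θ(d(s̄ c)) = s̄ (θ'(dc))` for every `c ∈ Γ(W')`.
[cite: Hartshorne2010, Remark 10.2.2, p. 82] [cite: Hartshorne2010, Remark 10.1.1, p. 81] [cite: Oort1971, §2.2 (pp. 277–280)] -/
theorem tangentSheaf_section_rep_transport {W : X.left.Opens} {W' : X'.left.Opens} (sbar : Γ(X'.left, W') ≃ₐ[A'] Γ(X.left, W))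
    {δ' : Derivation A' Γ(X'.left, W') (Γ(X'.left, W') ⊗[A'] ↥J)} {δ : Derivation A' Γ(X.left, W) (Γ(X.left, W) ⊗[A'] ↥J)}
    (hδ : ∀ x, δ (sbar x) = LinearMap.rTensor ↥J sbar.toLinearMap (δ' x))
    {θ' : (cotangentSheaf X').over W' ⟶ (unitModule X'.left).over W'} {θ : (cotangentSheaf X).over W ⟶ (unitModule X.left).over W}
    (hθ' : ∀ c : Γ(X'.left, W'), δ' c = (show Γ(X'.left, W') from appLE θ' (𝟙 W') (dSection X' W' c)) ⊗ₜ φ.symm 1)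
    (hθ : ∀ c : Γ(X.left, W), δ c = (show Γ(X.left, W) from appLE θ (𝟙 W) (dSection X W c)) ⊗ₜ φ.symm 1) (c : Γ(X'.left, W')) :
    (show Γ(X.left, W) from appLE θ (𝟙 W) (dSection X W (sbar c))) =
      sbar (show Γ(X'.left, W') from appLE θ' (𝟙 W') (dSection X' W' c)) :=
  sections_tmul_symm_one_injective hκ halg J φ (by rw [← hθ, hδ, hθ', LinearMap.rTensor_tmul, AlgEquiv.toLinearMap_apply])

/-- **Converse: a section whose values are the `s̄`-readback represents the conjugate reading.**  If `θ'` represents `δ'`,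
`δ (s̄ x) = (s̄ ⊗ 1)(δ' x)`, and `θ(d(s̄ c)) = s̄ (θ'(dc))` for all `c`, then `θ` represents `δ` (`s̄` is onto).
[cite: Hartshorne2010, Remark 10.2.2, p. 82] [cite: Hartshorne2010, Remark 10.1.1, p. 81] -/
theorem rep_of_readback {W : X.left.Opens} {W' : X'.left.Opens} (sbar : Γ(X'.left, W') ≃ₐ[A'] Γ(X.left, W))
    {δ' : Derivation A' Γ(X'.left, W') (Γ(X'.left, W') ⊗[A'] ↥J)} {δ : Derivation A' Γ(X.left, W) (Γ(X.left, W) ⊗[A'] ↥J)}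
    (hδ : ∀ x, δ (sbar x) = LinearMap.rTensor ↥J sbar.toLinearMap (δ' x))
    {θ' : (cotangentSheaf X').over W' ⟶ (unitModule X'.left).over W'} {θ : (cotangentSheaf X).over W ⟶ (unitModule X.left).over W}
    (hθ' : ∀ c : Γ(X'.left, W'), δ' c = (show Γ(X'.left, W') from appLE θ' (𝟙 W') (dSection X' W' c)) ⊗ₜ φ.symm 1)
    (hθθ' : ∀ c : Γ(X'.left, W'), (show Γ(X.left, W) from appLE θ (𝟙 W) (dSection X W (sbar c))) =
      sbar (show Γ(X'.left, W') from appLE θ' (𝟙 W') (dSection X' W' c))) (x : Γ(X.left, W)) :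
    δ x = (show Γ(X.left, W) from appLE θ (𝟙 W) (dSection X W x)) ⊗ₜ φ.symm 1 := by
  obtain ⟨c, rfl⟩ := sbar.surjective x
  rw [hδ, hθ', LinearMap.rTensor_tmul, AlgEquiv.toLinearMap_apply, hθθ']

end Section

/-! ## §3 The representing cochains agree componentwise through `s̄` -/

section Cochain

variable {ι : Type u} (U' : ι → X'.left.affineOpens) (U : ι → X.left.affineOpens)
  (sbar₃ : (a b d : ι) → Γ(X'.left, (U' a).1 ⊓ (U' b).1 ⊓ (U' d).1) ≃ₐ[A'] Γ(X.left, (U a).1 ⊓ (U b).1 ⊓ (U d).1))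
  {δ' : (a b d : ι) → Derivation A' Γ(X'.left, (U' a).1 ⊓ (U' b).1 ⊓ (U' d).1) (Γ(X'.left, (U' a).1 ⊓ (U' b).1 ⊓ (U' d).1) ⊗[A'] ↥J)}
  {δ : (a b d : ι) → Derivation A' Γ(X.left, (U a).1 ⊓ (U b).1 ⊓ (U d).1) (Γ(X.left, (U a).1 ⊓ (U b).1 ⊓ (U d).1) ⊗[A'] ↥J)}
  (hδδ' : ∀ a b d x, δ a b d (sbar₃ a b d x) = LinearMap.rTensor ↥J (sbar₃ a b d).toLinearMap (δ' a b d x))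
  {o' : CechMC2 X'.hom (tangentSheaf X') (fun a => (U' a).1)} {o : CechMC2 X.hom (tangentSheaf X) (fun a => (U a).1)}
  (ho' : ∀ (a b d : ι) (c : Γ(X'.left, (U' a).1 ⊓ (U' b).1 ⊓ (U' d).1)),
    δ' a b d c = (show Γ(X'.left, (U' a).1 ⊓ (U' b).1 ⊓ (U' d).1) from appLE (o' a b d) (𝟙 _) (dSection X' _ c)) ⊗ₜ φ.symm 1)

include hκ halg hδδ' ho' in
/-- **The obstruction cochain of the transported atlas, read back.**  On principal affine covers indexed alike (`U'` of `X'_κ`, `U` of `X_κ` —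
for the transport along `σ`: the traces of `V'` and of `σ⁻¹V'`) with the triple overlaps identified by `s̄_{abd}`: if `o'` represents the face
readings `δ'` and `o` represents face readings `δ` that are the `s̄`-conjugates of `δ'` (★ (vii-d) `reading_transport`), then
`o_{abd}(d(s̄ c)) = s̄_{abd}(o'_{abd}(dc))` — componentwise, `o` is `o'` read back through `s̄`.
[cite: Hartshorne2010, Remark 10.2.2, p. 82] [cite: Hartshorne2010, Thm. 10.2 (a) (proof), p. 81] [cite: Oort1971, §2.2 (pp. 277–280)] -/
theorem cochain_rep_transport
    (ho : ∀ (a b d : ι) (c : Γ(X.left, (U a).1 ⊓ (U b).1 ⊓ (U d).1)),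
      δ a b d c = (show Γ(X.left, (U a).1 ⊓ (U b).1 ⊓ (U d).1) from appLE (o a b d) (𝟙 _) (dSection X _ c)) ⊗ₜ φ.symm 1)
    (a b d : ι) (c : Γ(X'.left, (U' a).1 ⊓ (U' b).1 ⊓ (U' d).1)) :
    (show Γ(X.left, (U a).1 ⊓ (U b).1 ⊓ (U d).1) from appLE (o a b d) (𝟙 _) (dSection X _ (sbar₃ a b d c))) =
      sbar₃ a b d (show Γ(X'.left, (U' a).1 ⊓ (U' b).1 ⊓ (U' d).1) from appLE (o' a b d) (𝟙 _) (dSection X' _ c)) :=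
  tangentSheaf_section_rep_transport hκ halg J φ (sbar₃ a b d) (hδδ' a b d) (ho' a b d) (ho a b d) c

include hδδ' ho' in
/-- **Converse at the cochain level:** a cochain `o` on `U` whose components are the `s̄`-readback of `o'`'s REPRESENTS the transported face
readings (so, with ★ (vii) `cochain_rep_unique`, the representing cochain of the transported atlas is the readback of `o'` and nothing else).
[cite: Hartshorne2010, Remark 10.2.2, p. 82] [cite: Hartshorne2010, Thm. 10.2 (a) (proof), p. 81] -/
theorem cochain_rep_of_readback
    (hoo' : ∀ (a b d : ι) (c : Γ(X'.left, (U' a).1 ⊓ (U' b).1 ⊓ (U' d).1)),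
      (show Γ(X.left, (U a).1 ⊓ (U b).1 ⊓ (U d).1) from appLE (o a b d) (𝟙 _) (dSection X _ (sbar₃ a b d c))) =
        sbar₃ a b d (show Γ(X'.left, (U' a).1 ⊓ (U' b).1 ⊓ (U' d).1) from appLE (o' a b d) (𝟙 _) (dSection X' _ c)))
    (a b d : ι) (x : Γ(X.left, (U a).1 ⊓ (U b).1 ⊓ (U d).1)) :
    δ a b d x = (show Γ(X.left, (U a).1 ⊓ (U b).1 ⊓ (U d).1) from appLE (o a b d) (𝟙 _) (dSection X _ x)) ⊗ₜ φ.symm 1 :=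
  rep_of_readback J φ (sbar₃ a b d) (hδδ' a b d) (ho' a b d) (hoo' a b d) x

end Cochain

end Literature.AlgebraicGeometry.Deformation.AtlasTransportClassQuot

end
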